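import Literature.NumberTheory.EllipticCurves.GoodReductionInertia
import Literature.NumberTheory.EllipticCurves.X1ElevenKummerValues
import HarnessLib

/-!
# The `5`-descent on `X₁(11)`, III: the local engine — an inertial Galois translate of a point by
# an integral point reduces to a singular point; the node of `11A3` at `11` and its image

Third file of the explicit rendering of Mazur's Eisenstein descent for `N = 11` (B. Mazur,
*Modular curves and the Eisenstein ideal*, Publ. Math. IHÉS 47 (1977), Ch. III §3; overview in
`X1ElevenKummerValues`). This file is the **local** input of the constant-kernel side (the
descent through `φ : 11A3 → 11A1`, `ker φ = ⟨T⟩ ≅ ℤ/5`): the statement that the Galois torsors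
`φ⁻¹(P')`, `P' ∈ 11A1(ℚ)`, are unramified at every prime of good reduction — Silverman, *AEC*,
VIII.§1, proof of Prop. 1.5(b) / X.§4, proof of Thm. 4.2(b) ("`\widetilde{P^σ - P} = P̃^σ - P̃ =
Õ` since inertia acts trivially on `Ẽ`") — in a form valid at **all** primes, including the bad
prime `11` and the prime `5 = deg φ` (Mazur's point: the kernel `ℤ/5 ⊂ E` is étale over all of
`Spec ℤ`, Ch. III §5, p. 157, "`ℤ/N_{/S} ⊂ E_{/S}`"), over an arbitrary valued field `(L, w)`
(the tree's setting of `GoodReductionInertia`, whose lemmas are reused):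

* `add_eq_zero_or_one_lt_val_of_nonsingular` — the tree's `add_eq_zero_or_one_lt_val` ("two
  integral points with opposite reductions add up to `O` or into the kernel of reduction") with
  the global hypothesis `w Δ = 1` replaced by the nonsingularity of the reductions of the two
  points (the only use made of `w Δ = 1` in the tree's proof), so that it applies at a prime of
  multiplicative reduction to points reducing into the smooth locus;
* **`integral_and_partials_lt_one_of_map_eq_add`** — if `σ ∈ Aut(L/F₀)` preserves `w` and is
  inertial (`w (σ z - z) < 1` for `w z ≤ 1`), and an affine point `P` of a `w`-integral equation
  over `F₀` satisfies `P^σ = P + T₀` with `T₀` an **integral affine** point, then `P` is integral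
  and **reduces to a singular point** of the reduced cubic (both partial derivatives lie in
  `𝔪_w`); in particular this is impossible when `w Δ = 1` (`map_ne_add_of_val_Δ`);
* `curve11A3_node` — on `11A3 : y² + y = x³ - x²` at a place above `11` (`w 11 < 1`) the only
  singular reduction is the node `(8, 5)`: `w(x - 8) < 1`, `w(y - 5) < 1`;
* `curve11A3_node_image` — Vélu's formula `φ = (U/h², (S y + T)/h³)` of `X1ElevenFiveIsogeny`
  carries a point `≡ (8,5)` to an integral point `≡ (5,5)`, the node of `11A1 mod 11`
  (`U - 5h² ∈ (x - 8, 11)`, `Sy + T - 5h³ ∈ (y - 5, 11)`, `h - 1 ∈ (x - 8, 11)`).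

## References

* [SilvermanAEC2009] J. H. Silverman, *The Arithmetic of Elliptic Curves*, 2nd ed. (2009):
  Prop. VII.2.1 and its proof, VII.§3 Prop. 3.1, VIII.§1 proof of Prop. 1.5(b), X.§4 proof of
  Thm. 4.2(b).
* [Mazur1977] B. Mazur, *Modular curves and the Eisenstein ideal*, Publ. Math. IHÉS 47 (1977),
  Ch. III §5, p. 157 and Step 3, pp. 159–160 (the specialisations of `ℤ/N` at the bad primes).
* [Velu1971] J. Vélu, C. R. Acad. Sci. Paris 273 (1971), 238–241.

## Design

Theorems only; same conventions as `GoodReductionInertia` (`Valuation L ℝ≥0`, Mathlib's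
`IsIntegral w.integer`, `namespace Literature.NumberTheory.EllipticCurves`).
-/

noncomputable section

open scoped Classical NNReal
open Polynomial WeierstrassCurve

universe u

namespace Literature.NumberTheory.EllipticCurves

variable {L : Type u} [Field L] {w : Valuation L ℝ≥0} {V : WeierstrassCurve L}

/-! ### Integer literals have valuation `≤ 1` -/

/-- `w n ≤ 1` for every natural number `n` (non-archimedean triangle inequality). [folklore] -/
theorem val_natCast_le_one (w : Valuation L ℝ≥0) (n : ℕ) : w (n : L) ≤ 1 := by
  induction n with
  | zero => simp
  | succ n ih =>
    rw [Nat.cast_succ]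
    exact (Valuation.map_add w _ _).trans (max_le ih (le_of_eq (map_one w)))

/-- `w n ≤ 1` for every integer `n`. [folklore] -/
theorem val_intCast_le_one (w : Valuation L ℝ≥0) (n : ℤ) : w (n : L) ≤ 1 := by
  cases n with
  | ofNat n => simpa using val_natCast_le_one w n
  | negSucc n => rw [Int.cast_negSucc, Valuation.map_neg]; exact_mod_cast val_natCast_le_one w (n + 1)

/-! ### Sums of integral points with opposite nonsingular reductions -/

/-- **Two integral points with opposite *nonsingular* reductions sum into the kernel of
reduction** — the tree's `add_eq_zero_or_one_lt_val` (Silverman, *AEC*, Prop. VII.2.1, the case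
`P̃₁ = -P̃₂`) with its global hypothesis `w Δ = 1` replaced by what its proof uses: the two partial
derivatives are not both in `𝔪_w` at `P₁` and at `P₂` (the reductions `P̃₁, P̃₂` are nonsingular
points of the reduced cubic). On a `w`-integral equation let `P₁ = (x₁, y₁)`, `P₂ = (x₂, y₂)` be
integral with `w (x₁ - x₂) < 1`, `w (y₁ - (-y₂ - a₁x₂ - a₃)) < 1`; then `P₁ + P₂` is `O` or has
`w x(P₁ + P₂) > 1`. Proof: the tree's, verbatim. [cite: SilvermanAEC2009, Prop. VII.2.1 (proof, incl. Lemma 2.1.1)] -/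
theorem add_eq_zero_or_one_lt_val_of_nonsingular [hV : V.IsIntegral w.integer] {x₁ y₁ x₂ y₂ : L}
    {h₁ : V.toAffine.Nonsingular x₁ y₁} {h₂ : V.toAffine.Nonsingular x₂ y₂}
    (hx₁ : w x₁ ≤ 1) (hx₂ : w x₂ ≤ 1) (hdx : w (x₁ - x₂) < 1)
    (hdy : w (y₁ - V.toAffine.negY x₂ y₂) < 1)
    (hns₁ : ¬(w (V.toAffine.polynomialX.evalEval x₁ y₁) < 1 ∧
      w (V.toAffine.polynomialY.evalEval x₁ y₁) < 1))
    (hns₂ : ¬(w (V.toAffine.polynomialX.evalEval x₂ y₂) < 1 ∧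
      w (V.toAffine.polynomialY.evalEval x₂ y₂) < 1)) :
    Affine.Point.some x₁ y₁ h₁ + Affine.Point.some x₂ y₂ h₂ = 0 ∨
      ∃ (x₃ y₃ : L) (h₃ : V.toAffine.Nonsingular x₃ y₃),
        Affine.Point.some x₁ y₁ h₁ + Affine.Point.some x₂ y₂ h₂ = Affine.Point.some x₃ y₃ h₃ ∧
          1 < w x₃ := by
  have hy₁ : w y₁ ≤ 1 := val_y_le_one h₁.1 hx₁
  have hy₂ : w y₂ ≤ 1 := val_y_le_one h₂.1 hx₂
  obtain ⟨M, hM⟩ := hV.integral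
  by_cases hx : x₁ = x₂
  · subst hx
    by_cases hy : y₁ = V.toAffine.negY x₁ y₂
    · exact Or.inl (Affine.Point.add_of_Y_eq rfl hy)
    · -- tangent case: `P₁ = P₂` with `P̃₁` a `2`-torsion point of `Ẽ`
      have hy12 : y₁ = y₂ := (Affine.Y_eq_of_Y_ne h₁.1 h₂.1 rfl hy)
      subst hy12
      refine Or.inr ⟨_, _, _, Affine.Point.add_of_Y_ne hy, one_lt_val_addX hx₁ hx₁ ?_⟩
      rw [Affine.slope_of_Y_ne_eq_evalEval rfl hy, map_div₀, Valuation.map_neg]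
      have hD : y₁ - V.toAffine.negY x₁ y₁ = V.toAffine.polynomialY.evalEval x₁ y₁ := by
        rw [Affine.negY, Affine.evalEval_polynomialY]; ring
      have hDlt : w (V.toAffine.polynomialY.evalEval x₁ y₁) < 1 := hD ▸ hdy
      have hD0 : V.toAffine.polynomialY.evalEval x₁ y₁ ≠ 0 := hD ▸ sub_ne_zero.mpr hy
      have hN1 : w (V.toAffine.polynomialX.evalEval x₁ y₁) = 1 :=
        le_antisymm (val_polynomialX_le_one hx₁ hy₁)
          (not_lt.mp fun hlt ↦ hns₁ ⟨hlt, hDlt⟩)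
      rw [hN1, one_div, one_lt_inv₀ ((map_ne_zero w).mpr hD0 |> pos_iff_ne_zero.mpr)]
      exact hDlt
  · refine Or.inr ⟨_, _, _, Affine.Point.add_of_X_ne hx, one_lt_val_addX hx₁ hx₂ ?_⟩
    rw [Affine.slope_of_X_ne hx]
    have hE : y₁ - y₂ = (y₁ - V.toAffine.negY x₂ y₂) - V.toAffine.polynomialY.evalEval x₂ y₂ := by
      rw [Affine.negY, Affine.evalEval_polynomialY]; ring
    have hdx0 : x₁ - x₂ ≠ 0 := sub_ne_zero.mpr hx
    by_cases hpY : w (V.toAffine.polynomialY.evalEval x₂ y₂) < 1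
    · -- `P̃₂` is `2`-torsion: use the other expression of the slope
      have hpX : w (V.toAffine.polynomialX.evalEval x₂ y₂) = 1 :=
        le_antisymm (val_polynomialX_le_one hx₂ hy₂)
          (not_lt.mp fun hlt ↦ hns₂ ⟨hlt, hpY⟩)
      set E := y₁ - V.toAffine.negY x₂ y₂ with hEdef
      set N := x₁ ^ 2 + x₁ * x₂ + x₂ ^ 2 + V.a₂ * (x₁ + x₂) + V.a₄ - V.a₁ * y₁ with hNdef
      have hchord : (y₁ - y₂) * E = N * (x₁ - x₂) := by
        have e₁ := (Affine.equation_iff ..).mp h₁.1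
        have e₂ := (Affine.equation_iff ..).mp h₂.1
        rw [hEdef, hNdef, Affine.negY]
        linear_combination e₁ - e₂
      have hdy12 : w (y₁ - y₂) < 1 := by
        rw [hE]
        exact Valuation.map_sub_lt _ hdy hpY
      have hNeq : N = -V.toAffine.polynomialX.evalEval x₂ y₂ +
          ((x₁ - x₂) * (x₁ + 2 * x₂ + V.a₂) - V.a₁ * (y₁ - y₂)) := by
        rw [hNdef, Affine.evalEval_polynomialX]; ring
      have hN1 : w N = 1 := by
        have hlt : w ((x₁ - x₂) * (x₁ + 2 * x₂ + V.a₂) - V.a₁ * (y₁ - y₂)) < 1 := by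
          refine Valuation.map_sub_lt _ ?_ ?_
          · rw [map_mul]
            have hc : w (x₁ + 2 * x₂ + V.a₂) ≤ 1 := by
              refine (Valuation.map_add w _ _).trans (max_le ?_ val_a₂_le_one)
              refine (Valuation.map_add w _ _).trans (max_le hx₁ ?_)
              rw [map_mul]
              exact mul_le_one' (val_natCast_le_one w 2) hx₂
            calc w (x₁ - x₂) * w (x₁ + 2 * x₂ + V.a₂) ≤ w (x₁ - x₂) * 1 := by gcongr
              _ < 1 := by rw [mul_one]; exact hdx
          · rw [map_mul]
            calc w V.a₁ * w (y₁ - y₂) ≤ 1 * w (y₁ - y₂) := by gcongr; exact val_a₁_le_one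
              _ < 1 := by rw [one_mul]; exact hdy12
        rw [hNeq, Valuation.map_add_eq_of_lt_left, Valuation.map_neg, hpX]
        rw [Valuation.map_neg, hpX]
        exact hlt
      have hE0 : E ≠ 0 := by
        intro h0
        rw [h0, mul_zero, eq_comm, mul_eq_zero] at hchord
        rcases hchord with h' | h'
        · rw [h', map_zero] at hN1
          exact zero_ne_one hN1
        · exact hdx0 h'
      have hslope : (y₁ - y₂) / (x₁ - x₂) = N / E := by
        rw [div_eq_div_iff hdx0 hE0]
        exact hchord
      rw [hslope, map_div₀, hN1, one_div, one_lt_inv₀ ((map_ne_zero w).mpr hE0 |> pos_iff_ne_zero.mpr)]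
      exact hdy
    · -- `w (y₁ - y₂) = 1`
      rw [not_lt] at hpY
      have hpY1 : w (V.toAffine.polynomialY.evalEval x₂ y₂) = 1 :=
        le_antisymm (val_polynomialY_le_one hx₂ hy₂) hpY
      have hdy12 : w (y₁ - y₂) = 1 := by
        rw [hE, sub_eq_add_neg, Valuation.map_add_eq_of_lt_right, Valuation.map_neg, hpY1]
        rw [Valuation.map_neg, hpY1]
        exact hdy
      rw [map_div₀, hdy12, one_div,
        one_lt_inv₀ ((map_ne_zero w).mpr hdx0 |> pos_iff_ne_zero.mpr)]
      exact hdx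

/-! ### The dichotomy for an inertial Galois translate by an integral point -/

/-- The partial derivatives of the equation of `W/F₀` commute with `σ ∈ Aut(L/F₀)`. [folklore] -/
theorem evalEval_polynomialX_map {F₀ : Type*} [Field F₀] [Algebra F₀ L] (W : WeierstrassCurve F₀)
    (σ : L ≃ₐ[F₀] L) (x y : L) :
    (W.baseChange L).toAffine.polynomialX.evalEval (σ x) (σ y) =
      σ ((W.baseChange L).toAffine.polynomialX.evalEval x y) := by
  simp only [Affine.evalEval_polynomialX, baseChange, map_a₁, map_a₂, map_a₄, map_sub, map_mul,
    map_add, map_pow, AlgEquiv.commutes, map_ofNat]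

/-- The partial derivatives of the equation of `W/F₀` commute with `σ ∈ Aut(L/F₀)`. [folklore] -/
theorem evalEval_polynomialY_map {F₀ : Type*} [Field F₀] [Algebra F₀ L] (W : WeierstrassCurve F₀)
    (σ : L ≃ₐ[F₀] L) (x y : L) :
    (W.baseChange L).toAffine.polynomialY.evalEval (σ x) (σ y) =
      σ ((W.baseChange L).toAffine.polynomialY.evalEval x y) := by
  simp only [Affine.evalEval_polynomialY, baseChange, map_a₁, map_a₃, map_mul, map_add,
    AlgEquiv.commutes, map_ofNat]

/-- Singularity of the reduction is symmetric under negation: if both partials are in `𝔪_w` at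
`(x, -y - a₁x - a₃)` then they are at `(x, y)` (`F_y(x, -y-a₁x-a₃) = -F_y(x,y)`,
`F_x(x, -y-a₁x-a₃) = F_x(x,y) - a₁F_y(x,y)`). [folklore] -/
theorem partials_lt_one_of_negY [hV : V.IsIntegral w.integer] {x y : L}
    (h : w (V.toAffine.polynomialX.evalEval x (V.toAffine.negY x y)) < 1 ∧
      w (V.toAffine.polynomialY.evalEval x (V.toAffine.negY x y)) < 1) :
    w (V.toAffine.polynomialX.evalEval x y) < 1 ∧ w (V.toAffine.polynomialY.evalEval x y) < 1 := by
  obtain ⟨hX, hY⟩ := h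
  have eY : V.toAffine.polynomialY.evalEval x (V.toAffine.negY x y) =
      -V.toAffine.polynomialY.evalEval x y := by
    rw [Affine.evalEval_polynomialY, Affine.evalEval_polynomialY, Affine.negY]; ring
  have eX : V.toAffine.polynomialX.evalEval x (V.toAffine.negY x y) =
      V.toAffine.polynomialX.evalEval x y - V.a₁ * V.toAffine.polynomialY.evalEval x y := by
    rw [Affine.evalEval_polynomialX, Affine.evalEval_polynomialX, Affine.evalEval_polynomialY,
      Affine.negY]; ring
  rw [eY, Valuation.map_neg] at hY
  rw [eX] at hX
  refine ⟨?_, hY⟩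
  have : V.toAffine.polynomialX.evalEval x y = (V.toAffine.polynomialX.evalEval x y -
      V.a₁ * V.toAffine.polynomialY.evalEval x y) + V.a₁ * V.toAffine.polynomialY.evalEval x y := by
    ring
  rw [this]
  refine (Valuation.map_add w _ _).trans_lt (max_lt hX ?_)
  rw [map_mul]
  calc w V.a₁ * w (V.toAffine.polynomialY.evalEval x y) ≤ 1 * w (V.toAffine.polynomialY.evalEval x y) := by
        gcongr; exact val_a₁_le_one
    _ < 1 := by rw [one_mul]; exact hY

/-- **An inertial Galois translate of a point by a non-zero integral point reduces to a singular
point.** Let `(L, w)` be a valued field, `W` a Weierstrass equation over a subfield `F₀` which is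
`w`-integral, `σ ∈ Aut(L/F₀)` preserving `w` and inertial (`w (σ z - z) < 1` whenever
`w z ≤ 1`). If an affine point `P = (x, y) ∈ W(L)` satisfies **`P^σ = P + T₀`** for an affine
point `T₀ = (s, t)` with `w s ≤ 1`, then `P` is `w`-integral and both partial derivatives of the
equation lie in `𝔪_w` at `P` (i.e. `P̃` is a singular point of the reduced cubic). For: if
`w x > 1` then `P^σ = P + T₀` would have integral abscissa (tree `val_addX_le_one_of_one_lt`),
while `w (σ x) = w x > 1`; and if `P` is integral with nonsingular reduction then so are `P^σ` and
`-P`, which have opposite reductions (`σ ≡ id`), so that `T₀ = P^σ + (-P)` is `O` or non-integral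
(`add_eq_zero_or_one_lt_val_of_nonsingular`). This is the reduction step of Silverman, *AEC*,
VIII.§1 (proof of Prop. 1.5(b)) and X.§4 (proof of Thm. 4.2(b)), "`\widetilde{P^σ - P} = P̃^σ -
P̃ = Õ`", in the pointwise form needed at primes of bad reduction (Mazur's Step 3, p. 159: at a
bad prime the specialisation of `ℤ/N` either meets the identity component or the singular
point). [cite: SilvermanAEC2009, VIII.§1 proof of Prop. 1.5(b) and X.§4 proof of Thm. 4.2(b); Mazur1977, Ch. III §5 Step 3, p. 159] -/
theorem integral_and_partials_lt_one_of_map_eq_add {F₀ : Type*} [Field F₀] [Algebra F₀ L]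
    (W : WeierstrassCurve F₀) [(W.baseChange L).IsIntegral w.integer]
    (σ : L ≃ₐ[F₀] L) (hσ : ∀ z, w (σ z) = w z) (hσI : ∀ z, w z ≤ 1 → w (σ z - z) < 1)
    {x y s t : L} (hxy : (W.baseChange L).toAffine.Nonsingular x y)
    (hst : (W.baseChange L).toAffine.Nonsingular s t) (hs : w s ≤ 1)
    (hrel : Affine.Point.map (σ : L →ₐ[F₀] L) (Affine.Point.some x y hxy) =
      Affine.Point.some x y hxy + Affine.Point.some s t hst) :
    w x ≤ 1 ∧ w ((W.baseChange L).toAffine.polynomialX.evalEval x y) < 1 ∧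
      w ((W.baseChange L).toAffine.polynomialY.evalEval x y) < 1 := by
  set σ' : L →ₐ[F₀] L := (σ : L →ₐ[F₀] L)
  have ht : w t ≤ 1 := val_y_le_one hst.1 hs
  obtain ⟨hxy', hmap⟩ : ∃ h', Affine.Point.map σ' (.some x y hxy) = .some (σ' x) (σ' y) h' :=
    ⟨_, Affine.Point.map_some σ' hxy⟩
  rw [hmap] at hrel
  by_cases hx : w x ≤ 1
  · refine ⟨hx, ?_⟩
    by_contra hns
    have hy : w y ≤ 1 := val_y_le_one hxy.1 hx
    -- nonsingular reduction at `-P` and at `P^σ`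
    have hns₂ : ¬(w ((W.baseChange L).toAffine.polynomialX.evalEval x ((W.baseChange L).toAffine.negY x y)) < 1 ∧
        w ((W.baseChange L).toAffine.polynomialY.evalEval x ((W.baseChange L).toAffine.negY x y)) < 1) :=
      fun h => hns (partials_lt_one_of_negY h)
    have hns₁ : ¬(w ((W.baseChange L).toAffine.polynomialX.evalEval (σ' x) (σ' y)) < 1 ∧
        w ((W.baseChange L).toAffine.polynomialY.evalEval (σ' x) (σ' y)) < 1) := by
      rintro ⟨hX, hY⟩
      apply hns
      rw [show σ' x = σ x from rfl, show σ' y = σ y from rfl, evalEval_polynomialX_map W σ,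
        hσ] at hX
      rw [show σ' x = σ x from rfl, show σ' y = σ y from rfl, evalEval_polynomialY_map W σ,
        hσ] at hY
      exact ⟨hX, hY⟩
    -- `T₀ = P^σ + (-P)`
    have hT0 : Affine.Point.some (σ' x) (σ' y) hxy' - .some x y hxy = .some s t hst := by
      rw [hrel, add_sub_cancel_left]
    have hT : Affine.Point.some (σ' x) (σ' y) hxy' +
        .some x ((W.baseChange L).toAffine.negY x y) ((Affine.nonsingular_neg ..).mpr hxy) =
          .some s t hst := by
      rw [← hT0, sub_eq_add_neg, Affine.Point.neg_some]
    rcases add_eq_zero_or_one_lt_val_of_nonsingular (h₁ := hxy')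
        (h₂ := (Affine.nonsingular_neg ..).mpr hxy) (by rw [show σ' x = σ x from rfl, hσ]; exact hx)
        hx (hσI x hx) (by rw [Affine.negY_negY]; exact hσI y hy) hns₁ hns₂ with
      h0 | ⟨x₃, y₃, h₃, h3eq, hlt⟩
    · rw [hT] at h0
      exact Affine.Point.some_ne_zero _ h0
    · rw [hT, Affine.Point.some.injEq] at h3eq
      rw [h3eq.1] at hs
      exact absurd hs (not_le.mpr hlt)
  · -- `P` in the kernel of reduction: `P^σ = P + T₀` would have integral abscissa
    exfalso
    rw [not_le] at hx
    obtain ⟨hxs, hle⟩ := val_addX_le_one_of_one_lt hxy.1 hx hs ht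
    rw [Affine.Point.add_of_X_ne hxs, Affine.Point.some.injEq] at hrel
    have hle' : w (σ' x) ≤ 1 := hrel.1 ▸ hle
    rw [show σ' x = σ x from rfl, hσ] at hle'
    exact absurd hle' (not_le.mpr hx)

/-- **No inertial translate by an integral point at a prime of good reduction**: with
`w Δ = 1` the conclusion of `integral_and_partials_lt_one_of_map_eq_add` contradicts the
nonsingularity of `Ẽ` (tree `not_val_partial_lt_one`). This is the tree's
`map_eq_of_inertia_of_zsmul_sub_eq_zero` with the torsion hypothesis `n(P^σ - P) = O`, `w n = 1`
replaced by the integrality of `P^σ - P` (so it also covers `n`-torsion translates at primes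
dividing `n` when the torsion point is integral, e.g. `⟨(0,0)⟩ ⊂ 11A3` at `5`).
[cite: SilvermanAEC2009, X.§4 proof of Thm. 4.2(b) and VIII.§1 proof of Prop. 1.5(b)] -/
theorem map_ne_add_of_val_Δ {F₀ : Type*} [Field F₀] [Algebra F₀ L]
    (W : WeierstrassCurve F₀) [(W.baseChange L).IsIntegral w.integer]
    (hΔ : w (W.baseChange L).Δ = 1)
    (σ : L ≃ₐ[F₀] L) (hσ : ∀ z, w (σ z) = w z) (hσI : ∀ z, w z ≤ 1 → w (σ z - z) < 1)
    {x y s t : L} (hxy : (W.baseChange L).toAffine.Nonsingular x y)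
    (hst : (W.baseChange L).toAffine.Nonsingular s t) (hs : w s ≤ 1) :
    Affine.Point.map (σ : L →ₐ[F₀] L) (Affine.Point.some x y hxy) ≠
      Affine.Point.some x y hxy + Affine.Point.some s t hst := by
  intro hrel
  obtain ⟨hx, hX, hY⟩ := integral_and_partials_lt_one_of_map_eq_add W σ hσ hσI hxy hst hs hrel
  exact not_val_partial_lt_one hΔ hxy.1 hx ⟨hX, hY⟩

/-! ### `11A3` at a place above `11`: the node `(8, 5)` and its image `(5, 5)` under `φ` -/

section Eleven

open Literature.NumberTheory.EllipticCurves.X1Eleven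

variable (w)

/-- At a place above `11`, `2`, `3` and `5` are units. [folklore] -/
theorem val_eq_one_of_val_eleven_lt_one (h11 : w (11 : L) < 1) :
    w (2 : L) = 1 ∧ w (3 : L) = 1 ∧ w (5 : L) = 1 := by
  have key : ∀ (a b : ℕ), (a : L) * b = 11 + 1 ∨ (a : L) * b = 11 - 1 → w (a : L) = 1 := by
    intro a b hab
    have ha : w (a : L) ≤ 1 := val_natCast_le_one w a
    have hb : w (b : L) ≤ 1 := val_natCast_le_one w b
    by_contra hne
    have hlt : w ((a : L) * b) < 1 := by
      rw [map_mul]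
      calc w (a : L) * w (b : L) ≤ w (a : L) * 1 := by gcongr
        _ < 1 := by rw [mul_one]; exact lt_of_le_of_ne ha hne
    rcases hab with h | h
    · have : w (1 : L) < 1 := by
        rw [show (1 : L) = (a : L) * b - 11 by rw [h]; ring]
        exact Valuation.map_sub_lt _ hlt h11
      simp at this
    · have : w (1 : L) < 1 := by
        rw [show (1 : L) = 11 - (a : L) * b by rw [h]; ring]
        exact Valuation.map_sub_lt _ h11 hlt
      simp at this
  refine ⟨?_, ?_, ?_⟩
  · exact_mod_cast key 2 6 (Or.inl (by norm_num))
  · exact_mod_cast key 3 4 (Or.inl (by norm_num))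
  · exact_mod_cast key 5 2 (Or.inr (by norm_num))

/-- `11A3/L` is `w`-integral for every valuation `w` of `L` (integer coefficients). [folklore] -/
theorem isIntegral_curve11A3 [CharZero L] : (curve11A3.baseChange L).IsIntegral w.integer := by
  refine isIntegral_integer_of_val_le_one ?_ ?_ ?_ ?_ ?_ <;>
    simp [WeierstrassCurve.baseChange, curve11A3]

/-- **The singular reduction of `11A3` above `11` is the node `(8, 5)`.** If `w 11 < 1` and an
integral point `(x, y)` of `y² + y = x³ - x²` has both partials `-(3x² - 2x)` and `2y + 1` in
`𝔪_w`, then `w (x - 8) < 1` and `w (y - 5) < 1` (`2(y - 5) = (2y + 1) - 11`; `w x = 1` since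
otherwise `30 = (x³ - x²) - (y - 5)(y + 6) ∈ 𝔪_w`; `3(x - 8) = (3x - 2) - 22`).
[cite: CremonaAlgorithms1997, Table 1, N = 11 (A3: reduction type I₁ at 11)] -/
theorem curve11A3_node (h11 : w (11 : L) < 1) {x y : L} (he : y ^ 2 + y = x ^ 3 - x ^ 2)
    (hx : w x ≤ 1) (hy : w y ≤ 1) (hX : w (3 * x ^ 2 - 2 * x) < 1) (hY : w (2 * y + 1) < 1) :
    w (x - 8) < 1 ∧ w (y - 5) < 1 := by
  obtain ⟨h2, h3, h5⟩ := val_eq_one_of_val_eleven_lt_one w h11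
  have hy5 : w (y - 5) < 1 := by
    have : w (2 * (y - 5)) < 1 := by
      rw [show 2 * (y - 5) = (2 * y + 1) - 11 by ring]
      exact Valuation.map_sub_lt _ hY h11
    rwa [map_mul, h2, one_mul] at this
  refine ⟨?_, hy5⟩
  -- `w x = 1`
  have hx1 : w x = 1 := by
    by_contra hne
    have hxlt : w x < 1 := lt_of_le_of_ne hx hne
    have h30 : w (30 : L) < 1 := by
      have e : (30 : L) = (x ^ 3 - x ^ 2) - (y - 5) * (y + 6) := by linear_combination he
      rw [e]
      refine Valuation.map_sub_lt _ ?_ ?_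
      · rw [show x ^ 3 - x ^ 2 = x * (x ^ 2 - x) by ring, map_mul]
        calc w x * w (x ^ 2 - x) ≤ w x * 1 := by
              gcongr
              exact (Valuation.map_sub w _ _).trans
                (max_le (by rw [map_pow]; exact pow_le_one₀ zero_le hx) hx)
          _ < 1 := by rw [mul_one]; exact hxlt
      · rw [map_mul]
        calc w (y - 5) * w (y + 6) ≤ w (y - 5) * 1 := by
              gcongr
              exact (Valuation.map_add w _ _).trans (max_le hy (val_natCast_le_one w 6))
          _ < 1 := by rw [mul_one]; exact hy5
    have : w (30 : L) = 1 := by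
      rw [show (30 : L) = 2 * 3 * 5 by norm_num, map_mul, map_mul, h2, h3, h5]; norm_num
    exact absurd this (ne_of_lt h30)
  have h3x : w (3 * x - 2) < 1 := by
    have : w (x * (3 * x - 2)) < 1 := by rw [show x * (3 * x - 2) = 3 * x ^ 2 - 2 * x by ring]; exact hX
    rwa [map_mul, hx1, one_mul] at this
  have : w (3 * (x - 8)) < 1 := by
    rw [show 3 * (x - 8) = (3 * x - 2) - 2 * 11 by ring]
    refine Valuation.map_sub_lt _ h3x ?_
    rw [map_mul, h2, one_mul]; exact h11
  rwa [map_mul, h3, one_mul] at this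

/-- Valuation of an integer polynomial expression at an integral argument is `≤ 1`: the five
coefficient polynomials of Vélu's formula. [folklore] -/
theorem val_velu_le_one {x : L} (hx : w x ≤ 1) :
    w (x ^ 4 + x ^ 3 + 21 * x ^ 2 + 163 * x + 1302) ≤ 1 ∧
    w (x ^ 6 - 3 * x ^ 5 + x ^ 4 - 3 * x ^ 3 + 6 * x ^ 2 - 6 * x + 2) ≤ 1 ∧
    w (-x ^ 4 - x ^ 3 + 3 * x ^ 2 - 3 * x + 1) ≤ 1 ∧ w (x + 7) ≤ 1 ∧ w (x ^ 2 - x) ≤ 1 := by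
  have hp : ∀ n : ℕ, w (x ^ n) ≤ 1 := fun n => by rw [map_pow]; exact pow_le_one₀ zero_le hx
  have hc : ∀ (n : ℕ) (k : ℕ), w ((n : L) * x ^ k) ≤ 1 := fun n k => by
    rw [map_mul]; exact mul_le_one' (val_natCast_le_one w n) (hp k)
  have hadd : ∀ {a b : L}, w a ≤ 1 → w b ≤ 1 → w (a + b) ≤ 1 := fun ha hb =>
    (Valuation.map_add w _ _).trans (max_le ha hb)
  have hsub : ∀ {a b : L}, w a ≤ 1 → w b ≤ 1 → w (a - b) ≤ 1 := fun ha hb =>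
    (Valuation.map_sub w _ _).trans (max_le ha hb)
  have hneg : ∀ {a : L}, w a ≤ 1 → w (-a) ≤ 1 := fun ha => by rwa [Valuation.map_neg]
  refine ⟨?_, ?_, ?_, ?_, ?_⟩
  · exact hadd (hadd (hadd (hadd (hp 4) (hp 3)) (by simpa using hc 21 2)) (by simpa using hc 163 1))
      (val_natCast_le_one w 1302)
  · exact hadd (hsub (hadd (hsub (hadd (hsub (hp 6) (by simpa using hc 3 5)) (hp 4))
      (by simpa using hc 3 3)) (by simpa using hc 6 2)) (by simpa using hc 6 1)) (val_natCast_le_one w 2)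
  · exact hadd (hsub (hadd (hsub (hneg (hp 4)) (hp 3)) (by simpa using hc 3 2)) (by simpa using hc 3 1))
      (le_of_eq (map_one w))
  · exact hadd hx (val_natCast_le_one w 7)
  · exact hsub (hp 2) hx

/-- **The node of `11A3` maps to the node of `11A1`.** If `w 11 < 1` and `(x, y)` is integral with
`w (x - 8) < 1`, `w (y - 5) < 1`, then for Vélu's formula `φ(x, y) = (U(x)/h(x)², (S(x) y +
T(x))/h(x)³)` of `X1ElevenFiveIsogeny`: `h(x) = x² - x` is a unit, and both coordinates of
`φ(x, y)` are integral and `≡ 5`: `w(U/h² - 5) < 1`, `w((Sy + T)/h³ - 5) < 1` — from the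
identities `U - 5h² = (x - 8)(x⁴ + x³ + 21x² + 163x + 1302) + 11·947`,
`Sy + T - 5h³ = S(y - 5) + 11T`, `h - 1 = (x - 8)(x + 7) + 55`. [cite: Velu1971, formulae (example X₀(11))] -/
theorem curve11A3_node_image (h11 : w (11 : L) < 1) {x y : L} (hx : w x ≤ 1)
    (hx8 : w (x - 8) < 1) (hy5 : w (y - 5) < 1) :
    w (x ^ 2 - x) = 1 ∧
    w ((x ^ 5 - 2 * x ^ 4 + 3 * x ^ 3 - 2 * x + 1) / (x ^ 2 - x) ^ 2 - 5) < 1 ∧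
    w (((x ^ 6 - 3 * x ^ 5 + x ^ 4 - 3 * x ^ 3 + 6 * x ^ 2 - 6 * x + 2) * y +
        (-x ^ 4 - x ^ 3 + 3 * x ^ 2 - 3 * x + 1)) / (x ^ 2 - x) ^ 3 - 5) < 1 := by
  obtain ⟨h2, h3, h5⟩ := val_eq_one_of_val_eleven_lt_one w h11
  obtain ⟨hA, hS, hT, h7, hh⟩ := val_velu_le_one w hx
  -- `h(x)` is a unit
  have hh1 : w (x ^ 2 - x) = 1 := by
    have e : x ^ 2 - x = 1 + ((x - 8) * (x + 7) + 11 * 5) := by ring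
    rw [e]
    refine w.map_one_add_of_lt ((Valuation.map_add w _ _).trans_lt (max_lt ?_ ?_))
    · rw [map_mul]
      calc w (x - 8) * w (x + 7) ≤ w (x - 8) * 1 := by gcongr
        _ < 1 := by rw [mul_one]; exact hx8
    · rw [map_mul, h5, mul_one]; exact h11
  have hh0 : x ^ 2 - x ≠ 0 := fun h0 => by rw [h0, map_zero] at hh1; exact zero_ne_one hh1
  refine ⟨hh1, ?_, ?_⟩
  · have hD : (x ^ 2 - x) ^ 2 ≠ 0 := pow_ne_zero 2 hh0
    have e1 : (x ^ 5 - 2 * x ^ 4 + 3 * x ^ 3 - 2 * x + 1) - 5 * (x ^ 2 - x) ^ 2 =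
        (x - 8) * (x ^ 4 + x ^ 3 + 21 * x ^ 2 + 163 * x + 1302) + 11 * 947 := by ring
    rw [show (x ^ 5 - 2 * x ^ 4 + 3 * x ^ 3 - 2 * x + 1) / (x ^ 2 - x) ^ 2 - 5 =
      ((x ^ 5 - 2 * x ^ 4 + 3 * x ^ 3 - 2 * x + 1) - 5 * (x ^ 2 - x) ^ 2) / (x ^ 2 - x) ^ 2 by
        rw [sub_div, mul_div_cancel_right₀ _ hD], e1, map_div₀, map_pow, hh1, one_pow, div_one]
    refine (Valuation.map_add w _ _).trans_lt (max_lt ?_ ?_)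
    · rw [Valuation.map_mul]
      calc w (x - 8) * w _ ≤ w (x - 8) * 1 := by gcongr
        _ < 1 := by rw [mul_one]; exact hx8
    · rw [Valuation.map_mul]
      calc w (11 : L) * w (947 : L) ≤ w (11 : L) * 1 := by gcongr; exact val_natCast_le_one w 947
        _ < 1 := by rw [mul_one]; exact h11
  · have hD : (x ^ 2 - x) ^ 3 ≠ 0 := pow_ne_zero 3 hh0
    have e1 : ((x ^ 6 - 3 * x ^ 5 + x ^ 4 - 3 * x ^ 3 + 6 * x ^ 2 - 6 * x + 2) * y +
          (-x ^ 4 - x ^ 3 + 3 * x ^ 2 - 3 * x + 1)) - 5 * (x ^ 2 - x) ^ 3 =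
        (x ^ 6 - 3 * x ^ 5 + x ^ 4 - 3 * x ^ 3 + 6 * x ^ 2 - 6 * x + 2) * (y - 5) +
          11 * (-x ^ 4 - x ^ 3 + 3 * x ^ 2 - 3 * x + 1) := by ring
    rw [show ((x ^ 6 - 3 * x ^ 5 + x ^ 4 - 3 * x ^ 3 + 6 * x ^ 2 - 6 * x + 2) * y +
          (-x ^ 4 - x ^ 3 + 3 * x ^ 2 - 3 * x + 1)) / (x ^ 2 - x) ^ 3 - 5 =
      (((x ^ 6 - 3 * x ^ 5 + x ^ 4 - 3 * x ^ 3 + 6 * x ^ 2 - 6 * x + 2) * y +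
          (-x ^ 4 - x ^ 3 + 3 * x ^ 2 - 3 * x + 1)) - 5 * (x ^ 2 - x) ^ 3) / (x ^ 2 - x) ^ 3 by
        rw [sub_div, mul_div_cancel_right₀ _ hD], e1, map_div₀, map_pow, hh1, one_pow, div_one]
    refine (Valuation.map_add w _ _).trans_lt (max_lt ?_ ?_)
    · rw [Valuation.map_mul]
      calc w _ * w (y - 5) ≤ 1 * w (y - 5) := by gcongr
        _ < 1 := by rw [one_mul]; exact hy5
    · rw [Valuation.map_mul]
      calc w (11 : L) * w _ ≤ w (11 : L) * 1 := by gcongr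
        _ < 1 := by rw [mul_one]; exact h11

end Eleven

end Literature.NumberTheory.EllipticCurves

end
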